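import Summits.Ventures.HodgeRepro.CosetQuadCore
import Summits.Ventures.HodgeRepro.RectQuadThreshold

/-!
# The dihedral rectangle: the local patterns on `D_{2k}` (the `P`-side of a sixth mechanism)

Blind re-derivation cell `pub-hodge-repro`, seat `p1` (gen 11).  Route-2 g30 (INBOX L1130, «Theorem A», paper +
exhaustive enumeration) found the mechanism behind the non-abelian class `D′` of ROUTE-B §9.36: two involutions
`s, t` with `r = st` of order `2k`, `k ≥ 3` ODD, `r^k = c`, and the quadruple `Φ, Φs, Φt, Φ(st)`; an instance exists
iff `8k ≤ |G|`.  This file is the `P`-side of the kernel form on Mathlib's `DihedralGroup (2k)` (order `4k`,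
`r i`, `sr i = s · rⁱ`, `c = r k`): the two local patterns and the three hypotheses of gen 10's generic construction
`exists_quad_of_pattern` (CosetQuadCore.lean) —

* pattern `α` (`patA`): `χ(rᵃ) = [k ≤ a]`, `χ(s rᵇ) = ¬[k ≤ −b]` (indices read in `0 … 2k−1`) — the type
  `{r^k, …, r^{2k−1}} ∪ {s r^b : −b < k}`; its `SumTwo` is FORMAL (the four translates carry `x, ¬x, ¬y, y`);
* pattern `β` (`patB`): `χ(rᵃ) = χ(s rᵃ) = [a odd]` — needs `k` odd for the CM condition;
* `patternD_conj` (CM), `patternD_card` (`SumTwo` at every point), `patternD_noConj` (no pair of twists is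
  conjugate on BOTH patterns: pairs with `tⱼ tᵢ⁻¹ = s` are broken by `β`, all others by `α`, at explicit points).

`DihedralQuad.lean` supplies the hom `D_{2k} →* G` from `s, t` and the theorem `exists_dihedralQuad`.
-/

set_option autoImplicit false

open Finset DihedralGroup
open scoped Pointwise

namespace HodgeRepro.CosetQuad

section DihedralLocal

variable (k : ℕ) [NeZero k]

/-- `D_{2k}` as Mathlib's `DihedralGroup (2k)`: elements `r i`, `sr i` (`i : ℤ/2k`), order `4k`. -/
abbrev PD : Type := DihedralGroup (2 * k)

/-- The twists `1, s, t = s r, st = r` as elements of `D_{2k}`: `r 0, sr 0, sr 1, r 1`. -/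
def twistD (i : Fin 4) : PD k := ![r 0, sr 0, sr 1, r 1] i

/-- The central involution `c = r^k`. -/
def conjD : PD k := r (k : ZMod (2 * k))

/-- Pattern `α`: `χ(rᵃ) = [k ≤ a]`, `χ(s rᵇ) = ¬[k ≤ −b]`. -/
def patA : PD k → Bool
  | r a => decide (k ≤ a.val)
  | sr b => !decide (k ≤ (-b).val)

/-- Pattern `β`: `χ(rᵃ) = χ(s rᵃ) = [a odd]`. -/
def patB : PD k → Bool
  | r a => decide (Odd a.val)
  | sr b => decide (Odd b.val)

/-- The two-label pattern: label `0` is `α`, label `1` is `β`. -/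
def patternD (l : Fin 2) (p : PD k) : Bool := if l = 0 then patA k p else patB k p

omit [NeZero k] in
/-- `patternD 0 = patA`. -/
theorem patternD_zero (p : PD k) : patternD k 0 p = patA k p := if_pos rfl

omit [NeZero k] in
/-- `patternD 1 = patB`. -/
theorem patternD_one (p : PD k) : patternD k 1 p = patB k p := if_neg (by decide)

/-! ### Arithmetic in `ℤ/2k` -/

/-- `(k : ℤ/2k).val = k`. -/
theorem val_K : ((k : ℕ) : ZMod (2 * k)).val = k := by
  rw [ZMod.val_natCast]
  exact Nat.mod_eq_of_lt (by have := NeZero.ne k; omega)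

/-- `(a + k).val` in terms of `a.val`: `a.val + k` below `2k`, else `a.val − k`. -/
theorem val_add_K (a : ZMod (2 * k)) :
    (a + (k : ZMod (2 * k))).val = if a.val < k then a.val + k else a.val - k := by
  have hlt := ZMod.val_lt a
  rw [ZMod.val_add, val_K]
  split_ifs with h
  · exact Nat.mod_eq_of_lt (by omega)
  · rw [Nat.mod_eq_sub_mod (by omega), Nat.mod_eq_of_lt (by omega)]
    omega

/-- `k ≤ (a + k).val ↔ ¬ k ≤ a.val`. -/
theorem le_val_add_K_iff (a : ZMod (2 * k)) :
    k ≤ (a + (k : ZMod (2 * k))).val ↔ ¬ k ≤ a.val := by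
  have hlt := ZMod.val_lt a
  rw [val_add_K]
  split_ifs with h <;> omega

/-- `(a + b).val` and `a.val + b.val` have the same parity. -/
theorem val_add_mod_two (a b : ZMod (2 * k)) : (a + b).val % 2 = (a.val + b.val) % 2 := by
  rw [ZMod.val_add]
  exact Nat.mod_mod_of_dvd _ (Dvd.intro k rfl)

/-- `(−a).val` and `a.val` have the same parity. -/
theorem val_neg_mod_two (a : ZMod (2 * k)) : (-a).val % 2 = a.val % 2 := by
  rw [ZMod.neg_val]
  split_ifs with h
  · rw [h, ZMod.val_zero]
  · have hlt := ZMod.val_lt a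
    omega

/-- `(1 : ℤ/2k).val = 1`. -/
theorem val_one' : (1 : ZMod (2 * k)).val = 1 := by
  rw [ZMod.val_one_eq_one_mod]
  exact Nat.mod_eq_of_lt (by have := NeZero.ne k; omega)

/-- `(1 : ℤ/2k) ≠ 0`. -/
theorem one_ne_zero' : (1 : ZMod (2 * k)) ≠ 0 := fun h => by
  have := val_one' k
  rw [h, ZMod.val_zero] at this
  omega

/-- `(−1 : ℤ/2k).val = 2k − 1`. -/
theorem val_neg_one' : (-1 : ZMod (2 * k)).val = 2 * k - 1 := by
  rw [ZMod.neg_val, if_neg (one_ne_zero' k), val_one']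

omit [NeZero k] in
/-- `−(k : ℤ/2k) = k`. -/
theorem neg_K : -((k : ℕ) : ZMod (2 * k)) = ((k : ℕ) : ZMod (2 * k)) := by
  apply neg_eq_of_add_eq_zero_right
  rw [← Nat.cast_add, ← two_mul, ZMod.natCast_self]

omit [NeZero k] in
/-- `(1 − k : ℤ/2k) = k + 1` as a natural number cast. -/
theorem one_sub_K : (1 : ZMod (2 * k)) - ((k : ℕ) : ZMod (2 * k)) = ((k + 1 : ℕ) : ZMod (2 * k)) := by
  apply sub_eq_of_eq_add
  rw [← Nat.cast_add, show k + 1 + k = 2 * k + 1 by ring, Nat.cast_add, ZMod.natCast_self, zero_add,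
    Nat.cast_one]

/-- `(k − 1 : ℤ/2k) = k − 1` as a natural number cast. -/
theorem K_sub_one : ((k : ℕ) : ZMod (2 * k)) - 1 = ((k - 1 : ℕ) : ZMod (2 * k)) := by
  apply sub_eq_of_eq_add
  have e : ((k - 1 + 1 : ℕ) : ZMod (2 * k)) = ((k : ℕ) : ZMod (2 * k)) := by
    rw [Nat.sub_add_cancel (Nat.pos_of_ne_zero (NeZero.ne k))]
  rw [← e, Nat.cast_succ]

omit [NeZero k] in
/-- `(1 + k : ℤ/2k) = k + 1` as a natural number cast. -/
theorem one_add_K : (1 : ZMod (2 * k)) + ((k : ℕ) : ZMod (2 * k)) = ((k + 1 : ℕ) : ZMod (2 * k)) := by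
  rw [Nat.cast_add, Nat.cast_one, add_comm]

/-! ### The CM condition -/

omit [NeZero k] in
/-- `conjD` is central. -/
theorem mul_conjD_comm (p : PD k) : p * conjD k = conjD k * p := by
  cases p with
  | r a => simp only [conjD, r_mul_r, add_comm]
  | sr b =>
    simp only [conjD, sr_mul_r, r_mul_sr]
    rw [sub_eq_add_neg, neg_K]

/-- Pattern `α` satisfies the CM condition. -/
theorem patA_conj (p : PD k) : patA k (p * conjD k) = !patA k p := by
  cases p with
  | r a =>
    simp only [conjD, r_mul_r, patA]
    rw [← decide_not]
    exact decide_eq_decide.mpr (le_val_add_K_iff k a)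
  | sr b =>
    simp only [conjD, sr_mul_r, patA, Bool.not_not]
    rw [neg_add, neg_K, ← decide_not]
    apply decide_eq_decide.mpr
    rw [le_val_add_K_iff, not_not]

/-- Pattern `β` satisfies the CM condition when `k` is odd. -/
theorem patB_conj (hodd : Odd k) (p : PD k) : patB k (p * conjD k) = !patB k p := by
  have hk : k % 2 = 1 := Nat.odd_iff.mp hodd
  cases p with
  | r a =>
    simp only [conjD, r_mul_r, patB]
    rw [← decide_not]
    apply decide_eq_decide.mpr
    have h := val_add_mod_two k a (k : ZMod (2 * k))
    rw [val_K] at h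
    rw [Nat.odd_iff, Nat.odd_iff]; omega
  | sr b =>
    simp only [conjD, sr_mul_r, patB]
    rw [← decide_not]
    apply decide_eq_decide.mpr
    have h := val_add_mod_two k b (k : ZMod (2 * k))
    rw [val_K] at h
    rw [Nat.odd_iff, Nat.odd_iff]; omega

omit [NeZero k] in
/-- Every label is `0` or `1`. -/
theorem fin2_cases (l : Fin 2) : l = 0 ∨ l = 1 := by revert l; decide

/-- The CM condition for both labels. -/
theorem patternD_conj (hodd : Odd k) (l : Fin 2) (p : PD k) :
    patternD k l (p * conjD k) = !patternD k l p := by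
  rcases fin2_cases l with rfl | rfl
  · rw [patternD_zero, patternD_zero, patA_conj]
  · rw [patternD_one, patternD_one, patB_conj k hodd]

/-! ### `SumTwo` at every point -/

omit [NeZero k] in
/-- The four translates `p (t j)⁻¹` of `p = r a`. -/
theorem r_mul_twistD_inv (a : ZMod (2 * k)) :
    (r a * (twistD k 0)⁻¹ = r a) ∧ (r a * (twistD k 1)⁻¹ = sr (-a)) ∧
    (r a * (twistD k 2)⁻¹ = sr (1 - a)) ∧ (r a * (twistD k 3)⁻¹ = r (a - 1)) := by
  refine ⟨?_, ?_, ?_, ?_⟩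
  · show r a * (r 0)⁻¹ = r a
    rw [inv_r, neg_zero, r_mul_r, add_zero]
  · show r a * (sr 0)⁻¹ = sr (-a)
    rw [inv_sr, r_mul_sr, zero_sub]
  · show r a * (sr 1)⁻¹ = sr (1 - a)
    rw [inv_sr, r_mul_sr]
  · show r a * (r 1)⁻¹ = r (a - 1)
    rw [inv_r, r_mul_r, sub_eq_add_neg]

omit [NeZero k] in
/-- The four translates `p (t j)⁻¹` of `p = sr b`. -/
theorem sr_mul_twistD_inv (b : ZMod (2 * k)) :
    (sr b * (twistD k 0)⁻¹ = sr b) ∧ (sr b * (twistD k 1)⁻¹ = r (-b)) ∧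
    (sr b * (twistD k 2)⁻¹ = r (1 - b)) ∧ (sr b * (twistD k 3)⁻¹ = sr (b - 1)) := by
  refine ⟨?_, ?_, ?_, ?_⟩
  · show sr b * (r 0)⁻¹ = sr b
    rw [inv_r, neg_zero, sr_mul_r, add_zero]
  · show sr b * (sr 0)⁻¹ = r (-b)
    rw [inv_sr, sr_mul_sr, zero_sub]
  · show sr b * (sr 1)⁻¹ = r (1 - b)
    rw [inv_sr, sr_mul_sr]
  · show sr b * (r 1)⁻¹ = sr (b - 1)
    rw [inv_r, sr_mul_r, sub_eq_add_neg]

omit [NeZero k] in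
/-- The count of the four translates for a pattern `χ`, as a sum of `toNat`s. -/
theorem card_filter_twistD (χ : PD k → Bool) (p : PD k) :
    (univ.filter fun j : Fin 4 => χ (p * (twistD k j)⁻¹) = true).card = 2 ↔
      (χ (p * (twistD k 0)⁻¹)).toNat + (χ (p * (twistD k 1)⁻¹)).toNat +
        (χ (p * (twistD k 2)⁻¹)).toNat + (χ (p * (twistD k 3)⁻¹)).toNat = 2 := by
  have hv : (univ.filter fun j : Fin 4 => χ (p * (twistD k j)⁻¹) = true) =
      univ.filter fun j : Fin 4 => ![χ (p * (twistD k 0)⁻¹), χ (p * (twistD k 1)⁻¹),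
        χ (p * (twistD k 2)⁻¹), χ (p * (twistD k 3)⁻¹)] j = true := by
    apply Finset.filter_congr
    intro j _
    fin_cases j <;> rfl
  rw [hv, card_filter_vec_eq_two_iff]

omit [NeZero k] in
/-- Pattern `α` is `SumTwo` at every point (formally: the translates carry `x, ¬x, ¬y, y`). -/
theorem patA_card (p : PD k) :
    (univ.filter fun j : Fin 4 => patA k (p * (twistD k j)⁻¹) = true).card = 2 := by
  rw [card_filter_twistD]
  cases p with
  | r a =>
    obtain ⟨h0, h1, h2, h3⟩ := r_mul_twistD_inv k a
    rw [h0, h1, h2, h3]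
    simp only [patA, neg_neg, neg_sub]
    have e1 := toNat_not_add (decide (k ≤ a.val))
    have e2 := toNat_not_add (decide (k ≤ (a - 1).val))
    omega
  | sr b =>
    obtain ⟨h0, h1, h2, h3⟩ := sr_mul_twistD_inv k b
    rw [h0, h1, h2, h3]
    simp only [patA, neg_sub]
    have e1 := toNat_not_add (decide (k ≤ (-b).val))
    have e2 := toNat_not_add (decide (k ≤ (1 - b).val))
    omega

/-- The parities of `a, −a, 1 − a, a − 1`: `a, a, ¬a, ¬a`. -/
theorem parity_four (a : ZMod (2 * k)) :
    (-a).val % 2 = a.val % 2 ∧ (1 - a).val % 2 = (a.val + 1) % 2 ∧ (a - 1).val % 2 = (a.val + 1) % 2 := by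
  have hk := NeZero.ne k
  refine ⟨val_neg_mod_two k a, ?_, ?_⟩
  · rw [sub_eq_add_neg, val_add_mod_two, val_one']
    have := val_neg_mod_two k a
    omega
  · rw [sub_eq_add_neg, val_add_mod_two, val_neg_one']; omega

/-- Pattern `β` is `SumTwo` at every point. -/
theorem patB_card (p : PD k) :
    (univ.filter fun j : Fin 4 => patB k (p * (twistD k j)⁻¹) = true).card = 2 := by
  rw [card_filter_twistD]
  cases p with
  | r a =>
    obtain ⟨h0, h1, h2, h3⟩ := r_mul_twistD_inv k a
    rw [h0, h1, h2, h3]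
    simp only [patB]
    obtain ⟨p1, p2, p3⟩ := parity_four k a
    have e1 : decide (Odd (-a).val) = decide (Odd a.val) :=
      decide_eq_decide.mpr (by rw [Nat.odd_iff, Nat.odd_iff, p1])
    have e2 : decide (Odd (1 - a).val) = !decide (Odd a.val) := by
      rw [← decide_not]; exact decide_eq_decide.mpr (by rw [Nat.odd_iff, Nat.odd_iff, p2]; omega)
    have e3 : decide (Odd (a - 1).val) = !decide (Odd a.val) := by
      rw [← decide_not]; exact decide_eq_decide.mpr (by rw [Nat.odd_iff, Nat.odd_iff, p3]; omega)
    rw [e1, e2, e3]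
    have := toNat_not_add (decide (Odd a.val))
    omega
  | sr b =>
    obtain ⟨h0, h1, h2, h3⟩ := sr_mul_twistD_inv k b
    rw [h0, h1, h2, h3]
    simp only [patB]
    obtain ⟨p1, p2, p3⟩ := parity_four k b
    have e1 : decide (Odd (-b).val) = decide (Odd b.val) :=
      decide_eq_decide.mpr (by rw [Nat.odd_iff, Nat.odd_iff, p1])
    have e2 : decide (Odd (1 - b).val) = !decide (Odd b.val) := by
      rw [← decide_not]; exact decide_eq_decide.mpr (by rw [Nat.odd_iff, Nat.odd_iff, p2]; omega)
    have e3 : decide (Odd (b - 1).val) = !decide (Odd b.val) := by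
      rw [← decide_not]; exact decide_eq_decide.mpr (by rw [Nat.odd_iff, Nat.odd_iff, p3]; omega)
    rw [e1, e2, e3]
    have := toNat_not_add (decide (Odd b.val))
    omega

/-- `SumTwo` for both labels. -/
theorem patternD_card (l : Fin 2) (p : PD k) :
    (univ.filter fun j : Fin 4 => patternD k l (p * (twistD k j)⁻¹) = true).card = 2 := by
  rcases fin2_cases l with rfl | rfl
  · simp only [patternD_zero]; exact patA_card k p
  · simp only [patternD_one]; exact patB_card k p

end DihedralLocal

end HodgeRepro.CosetQuad
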